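import Mathlib.Analysis.InnerProductSpace.Projection.FiniteDimensional
import Literature.Analysis.FluidPDE.TaoAveragedCascadeSteps
import Literature.Analysis.FluidPDE.TaoAveragedSlotSobolev
import HarnessLib

/-!
# Rotating and dilating complex Schwartz profiles; normalising the Fourier support (Tao 2016, §3.2)

T. Tao, *Finite time blowup for an averaged three-dimensional Navier–Stokes equation*,
J. Amer. Math. Soc. **29** (2016), 601–674 = arXiv:1402.0290v3 (held as `paper:arxiv-1402.0290`),
§3.2, pp. 15–16: the complexified profiles `ψⱼ : ℝ³ → ℂ³` have `ψ̂ⱼ` "supported on the ball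
`B(ξⱼ⁰, ε₀³)` for some non-zero `ξⱼ⁰ ∈ ℝ³` with magnitude comparable to `1` … due to the presence
of rotations and dilations in the definition of a complex average, we have the freedom to rotate
and dilate each of the `ξⱼ⁰` as we please. We shall select the normalisation (3.7)". This file
provides, as honest Schwartz-level constructions with proofs:

* `schwartzRot R φ` — `Rot_R φ (x) = R φ(R⁻¹x)` of a complex Schwartz field, and `schwartzDilC c hc φ`
  — `Dil_c φ (x) = c^{3/2} φ(cx)` (`c > 0`), with `toLp_schwartzRot` / `toLp_schwartzDilC`: their
  `L²` classes are the tree's `rot R` / `dil c` of the class of `φ`;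
* `fourier_schwartzRot`, `fourier_schwartzDilC` — their Fourier integrals, and
  `HasBallFourierSupport.schwartzRot` / `.schwartzDilC` — a ball Fourier support `B(ξ₀, r)` is
  carried to `B(R ξ₀, r)` / `B(c ξ₀, c r)`;
* `exists_rotation_apply_eq` — for unit vectors `a, b ∈ ℝ³` a rotation `R ∈ SO(3)` (linear
  isometry of determinant `1`) with `R a = b` (a half-turn about `a + b`, or about an axis
  orthogonal to `a` when `b = -a`);
* `exists_normalising_rotDil` — **the normalisation**: a profile with `ψ̂` supported in
  `B(c₀, r)`, `c₀ ≠ 0`, is carried by `Rot_R Dil_κ` (`κ = |ξ₁|/|c₀|`, `R (c₀/|c₀|) = ξ₁/|ξ₁|`) to a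
  profile with Fourier support in `B(ξ₁, κ r)`, for any prescribed non-zero centre `ξ₁` (used with
  `ξ₁ = ξⱼ⁰` of (3.7)).

## References

* T. Tao, J. Amer. Math. Soc. 29 (2016), 601–674, arXiv:1402.0290v3, §1.1 p. 6 (`Rot_R`, (1.11)),
  §3.2 pp. 15–16 ((3.6), (3.7)). Key `Tao2016AveragedNS`.
-/

noncomputable section

open MeasureTheory Set Filter FourierTransform
open scoped ENNReal NNReal SchwartzMap ComplexConjugate RealInnerProductSpace

namespace Literature.Analysis.FluidPDE.Tao2016

/-- Local notation for physical / frequency space `ℝ³`. -/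
local notation "ℝ³" => EuclideanSpace ℝ (Fin 3)
/-- Local notation for the complexified range `ℂ³`. -/
local notation "ℂ³" => EuclideanSpace ℂ (Fin 3)

/-! ### Rotations and dilations of complex Schwartz profiles -/

/-- **Rotation of a complex Schwartz field**: `Rot_R φ (x) = (R ⊗ 1) φ(R⁻¹ x)` (Tao p. 6), as a
Schwartz map (precomposition with the linear isometry `R⁻¹`, postcomposition with the complexified
matrix of `R`). [cite: Tao2016AveragedNS, §1.1 p. 6] -/
def schwartzRot (R : ℝ³ ≃ₗᵢ[ℝ] ℝ³) (φ : 𝓢(ℝ³, ℂ³)) : 𝓢(ℝ³, ℂ³) :=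
  SchwartzMap.postcompCLM (rotMat R)
    (SchwartzMap.compCLMOfContinuousLinearEquiv ℂ R.symm.toContinuousLinearEquiv φ)

/-- `Rot_R φ (x) = (R ⊗ 1) φ(R⁻¹ x)`. [cite: Tao2016AveragedNS, §1.1 p. 6] -/
@[simp]
theorem schwartzRot_apply (R : ℝ³ ≃ₗᵢ[ℝ] ℝ³) (φ : 𝓢(ℝ³, ℂ³)) (x : ℝ³) :
    schwartzRot R φ x = rotMat R (φ (R.symm x)) := rfl

/-- `Rot_R φ` as a function. [folklore] -/
theorem coe_schwartzRot (R : ℝ³ ≃ₗᵢ[ℝ] ℝ³) (φ : 𝓢(ℝ³, ℂ³)) :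
    ⇑(schwartzRot R φ) = fun x => rotMat R (φ (R.symm x)) := rfl

/-- **`L²`-normalised dilation of a complex Schwartz field**: `Dil_c φ (x) = c^{3/2} φ(c x)`,
`c > 0` (Tao (1.11)), as a Schwartz map. [cite: Tao2016AveragedNS, (1.11)] -/
def schwartzDilC (c : ℝ) (hc : 0 < c) (φ : 𝓢(ℝ³, ℂ³)) : 𝓢(ℝ³, ℂ³) :=
  (((c ^ (3 / 2 : ℝ) : ℝ)) : ℂ) •
    SchwartzMap.compCLMOfContinuousLinearEquiv ℂ
      (ContinuousLinearEquiv.smulLeft (Units.mk0 c hc.ne') : ℝ³ ≃L[ℝ] ℝ³) φ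

/-- `Dil_c φ (x) = c^{3/2} φ(c x)`. [cite: Tao2016AveragedNS, (1.11)] -/
@[simp]
theorem schwartzDilC_apply {c : ℝ} (hc : 0 < c) (φ : 𝓢(ℝ³, ℂ³)) (x : ℝ³) :
    schwartzDilC c hc φ x = (((c ^ (3 / 2 : ℝ) : ℝ)) : ℂ) • φ (c • x) := rfl

/-- `Dil_c φ` as a function. [folklore] -/
theorem coe_schwartzDilC {c : ℝ} (hc : 0 < c) (φ : 𝓢(ℝ³, ℂ³)) :
    ⇑(schwartzDilC c hc φ) = fun x => (((c ^ (3 / 2 : ℝ) : ℝ)) : ℂ) • φ (c • x) := rfl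

/-- **The Schwartz-level and `L²`-level rotations agree.** [cite: Tao2016AveragedNS, §1.1 p. 6] -/
theorem toLp_schwartzRot (R : ℝ³ ≃ₗᵢ[ℝ] ℝ³) (φ : 𝓢(ℝ³, ℂ³)) :
    (schwartzRot R φ).toLp 2 (volume : Measure ℝ³) = rot R (φ.toLp 2 (volume : Measure ℝ³)) := by
  apply Lp.ext
  filter_upwards [(schwartzRot R φ).coeFn_toLp 2 (volume : Measure ℝ³), coeFn_rot R (φ.toLp 2),
    R.symm.measurePreserving.quasiMeasurePreserving.ae_eq (φ.coeFn_toLp 2 (volume : Measure ℝ³))]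
    with x h1 h2 h3
  simp only [Function.comp_apply] at h3
  rw [h1, h2, h3]
  rfl

/-- **The Schwartz-level and `L²`-level dilations agree.** [cite: Tao2016AveragedNS, (1.11)] -/
theorem toLp_schwartzDilC {c : ℝ} (hc : 0 < c) (φ : 𝓢(ℝ³, ℂ³)) :
    (schwartzDilC c hc φ).toLp 2 (volume : Measure ℝ³) = dil c (φ.toLp 2 (volume : Measure ℝ³)) := by
  apply Lp.ext
  have hq : Measure.QuasiMeasurePreserving (fun x : ℝ³ => c • x) volume volume :=
    Measure.quasiMeasurePreserving_smul volume hc.ne'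
  filter_upwards [(schwartzDilC c hc φ).coeFn_toLp 2 (volume : Measure ℝ³),
    coeFn_dil hc.ne' (φ.toLp 2), hq.ae_eq (φ.coeFn_toLp 2 (volume : Measure ℝ³))] with x h1 h2 h3
  simp only [Function.comp_apply] at h3
  rw [h1, h2, h3]
  rfl

/-- **Fourier integral of a rotated profile**: `𝓕(Rot_R φ)(ξ) = (R ⊗ 1) φ̂(R⁻¹ξ)`. [cite: Tao2016AveragedNS, §1.1 p. 6] -/
theorem fourier_schwartzRot (R : ℝ³ ≃ₗᵢ[ℝ] ℝ³) (φ : 𝓢(ℝ³, ℂ³)) (ξ : ℝ³) :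
    𝓕 (⇑(schwartzRot R φ)) ξ = rotMat R (𝓕 (⇑φ) (R.symm ξ)) := by
  rw [coe_schwartzRot]
  exact fourierIntegral_rot R φ.integrable ξ

/-- **Fourier integral of a dilated profile**: `𝓕(Dil_c φ)(ξ) = c^{-3/2} φ̂(ξ/c)`. [cite: Tao2016AveragedNS, (1.11)] -/
theorem fourier_schwartzDilC {c : ℝ} (hc : 0 < c) (φ : 𝓢(ℝ³, ℂ³)) (ξ : ℝ³) :
    𝓕 (⇑(schwartzDilC c hc φ)) ξ = (((c⁻¹ ^ (3 / 2 : ℝ) : ℝ)) : ℂ) • 𝓕 (⇑φ) (c⁻¹ • ξ) := by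
  rw [coe_schwartzDilC]
  exact fourierIntegral_dil hc (⇑φ) ξ

/-! ### Transport of ball Fourier supports -/

/-- A ball Fourier support is monotone in the radius. [folklore] -/
theorem HasBallFourierSupport.mono {ξ₀ : ℝ³} {r r' : ℝ} {φ : 𝓢(ℝ³, ℂ³)}
    (h : HasBallFourierSupport ξ₀ r φ) (hr : r ≤ r') : HasBallFourierSupport ξ₀ r' φ :=
  fun ξ hξ => h ξ (lt_of_le_of_lt hr hξ)

/-- **Rotations carry `B(ξ₀, r)`-supports to `B(Rξ₀, r)`-supports.** [cite: Tao2016AveragedNS, §3.2 p. 15] -/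
theorem HasBallFourierSupport.schwartzRot {ξ₀ : ℝ³} {r : ℝ} {φ : 𝓢(ℝ³, ℂ³)}
    (h : HasBallFourierSupport ξ₀ r φ) (R : ℝ³ ≃ₗᵢ[ℝ] ℝ³) :
    HasBallFourierSupport (R ξ₀) r (schwartzRot R φ) := by
  intro ξ hξ
  have hξ' : r < dist (R.symm ξ) ξ₀ := by
    rw [← R.symm_apply_apply ξ₀, LinearIsometryEquiv.dist_map]
    exact hξ
  rw [fourier_schwartzRot, h (R.symm ξ) hξ', map_zero]

/-- **Dilations carry `B(ξ₀, r)`-supports to `B(cξ₀, cr)`-supports** (`c > 0`). [cite: Tao2016AveragedNS, §3.2 p. 15] -/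
theorem HasBallFourierSupport.schwartzDilC {ξ₀ : ℝ³} {r : ℝ} {φ : 𝓢(ℝ³, ℂ³)}
    (h : HasBallFourierSupport ξ₀ r φ) {c : ℝ} (hc : 0 < c) :
    HasBallFourierSupport (c • ξ₀) (c * r) (schwartzDilC c hc φ) := by
  intro ξ hξ
  have hξ' : r < dist (c⁻¹ • ξ) ξ₀ := by
    rw [dist_eq_norm, show c⁻¹ • ξ - ξ₀ = c⁻¹ • (ξ - c • ξ₀) by
      rw [smul_sub, inv_smul_smul₀ hc.ne'], norm_smul, Real.norm_of_nonneg (inv_nonneg.2 hc.le),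
      ← dist_eq_norm, lt_inv_mul_iff₀ hc]
    exact hξ
  rw [fourier_schwartzDilC, h (c⁻¹ • ξ) hξ', smul_zero]

/-! ### Rotations of `ℝ³` between prescribed directions -/

section Rotations

open Module Submodule

/-- The half-turn about a non-zero axis `v` (the reflection in the line `ℝ v`) has determinant `1`
in dimension `3`. [folklore] -/
theorem det_reflection_span_singleton_eq_one {v : ℝ³} (hv : v ≠ 0) :
    LinearMap.det (((ℝ ∙ v).reflection).toLinearEquiv : ℝ³ →ₗ[ℝ] ℝ³) = 1 := by
  have h := (ℝ ∙ v).det_reflection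
  haveI : Fact (finrank ℝ ℝ³ = 2 + 1) := ⟨by rw [finrank_euclideanSpace_fin]⟩
  rw [finrank_orthogonal_span_singleton (𝕜 := ℝ) (n := 2) hv] at h
  rw [h]
  norm_num

/-- **Any unit vector of `ℝ³` is rotated onto any other by an element of `SO(3)`**: for
`‖a‖ = ‖b‖ = 1` there is a linear isometry `R` of determinant `1` with `R a = b` (the half-turn
about `a + b`; if `b = -a`, the half-turn about an axis orthogonal to `a`). [folklore] -/
theorem exists_rotation_apply_eq {a b : ℝ³} (ha : ‖a‖ = 1) (hb : ‖b‖ = 1) :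
    ∃ R : ℝ³ ≃ₗᵢ[ℝ] ℝ³, LinearMap.det (R.toLinearEquiv : ℝ³ →ₗ[ℝ] ℝ³) = 1 ∧ R a = b := by
  have ha0 : a ≠ 0 := fun h => by simp [h] at ha
  by_cases hanti : b = -a
  · -- half-turn about an axis `w ⊥ a`
    obtain ⟨w, hwK, hw⟩ : ∃ w ∈ (ℝ ∙ a)ᗮ, w ≠ 0 := by
      rw [← Submodule.ne_bot_iff]
      intro hbot
      have h1 := Submodule.finrank_add_finrank_orthogonal (ℝ ∙ a)
      rw [hbot, finrank_bot, add_zero, finrank_euclideanSpace_fin, finrank_span_singleton ha0] at h1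
      omega
    refine ⟨(ℝ ∙ w).reflection, det_reflection_span_singleton_eq_one hw, ?_⟩
    have ha' : a ∈ (ℝ ∙ w)ᗮ := by
      rw [Submodule.mem_orthogonal_singleton_iff_inner_right]
      rw [Submodule.mem_orthogonal_singleton_iff_inner_right] at hwK
      rw [real_inner_comm]
      exact hwK
    rw [reflection_mem_subspace_orthogonalComplement_eq_neg ha', hanti]
  · have hw : a + b ≠ 0 := fun h => hanti (eq_neg_of_add_eq_zero_right h)
    refine ⟨(ℝ ∙ (a + b)).reflection, det_reflection_span_singleton_eq_one hw, ?_⟩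
    have h1 : (ℝ ∙ (a + b))ᗮ.reflection a = -b := by
      have := reflection_sub (F := ℝ³) (v := a) (w := -b) (by rw [norm_neg, ha, hb])
      rwa [sub_neg_eq_add] at this
    have h2 := reflection_orthogonal_apply (ℝ ∙ (a + b)) a
    exact neg_injective (h2.symm.trans h1)

end Rotations

/-! ### The normalisation of a ball-supported profile -/

/-- **Normalising the Fourier support of a profile by a rotation and a dilation** (Tao §3.2: "we
have the freedom to rotate and dilate each of the `ξⱼ⁰` as we please"): if `φ̂` is supported in
`B(c₀, r)` with `c₀ ≠ 0`, and `ξ₁ ≠ 0` is a prescribed centre, then with `κ = |ξ₁|/|c₀|` and a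
rotation `R ∈ SO(3)` taking the direction of `c₀` to that of `ξ₁`, the profile
`φ' = Rot_R Dil_κ φ` — whose `L²` class is `Rot_R Dil_κ` of the class of `φ` — has `φ̂'`
supported in `B(ξ₁, κ r)`. [cite: Tao2016AveragedNS, §3.2 pp. 15–16] -/
theorem exists_normalising_rotDil {c₀ ξ₁ : ℝ³} (hc₀ : c₀ ≠ 0) (hξ₁ : ξ₁ ≠ 0) {r : ℝ}
    (φ : 𝓢(ℝ³, ℂ³)) (hφ : HasBallFourierSupport c₀ r φ) :
    ∃ (R : ℝ³ ≃ₗᵢ[ℝ] ℝ³) (φ' : 𝓢(ℝ³, ℂ³)),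
      LinearMap.det (R.toLinearEquiv : ℝ³ →ₗ[ℝ] ℝ³) = 1 ∧
      φ'.toLp 2 (volume : Measure ℝ³) =
        rot R (dil (‖ξ₁‖ / ‖c₀‖) (φ.toLp 2 (volume : Measure ℝ³))) ∧
      HasBallFourierSupport ξ₁ (‖ξ₁‖ / ‖c₀‖ * r) φ' := by
  have hnc : 0 < ‖c₀‖ := norm_pos_iff.2 hc₀
  have hnξ : 0 < ‖ξ₁‖ := norm_pos_iff.2 hξ₁
  set κ : ℝ := ‖ξ₁‖ / ‖c₀‖ with hκ
  have hκpos : 0 < κ := div_pos hnξ hnc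
  obtain ⟨R, hdet, hR⟩ := exists_rotation_apply_eq (a := ‖c₀‖⁻¹ • c₀) (b := ‖ξ₁‖⁻¹ • ξ₁)
    (norm_smul_inv_norm hc₀) (norm_smul_inv_norm hξ₁)
  refine ⟨R, schwartzRot R (schwartzDilC κ hκpos φ), hdet, ?_, ?_⟩
  · rw [toLp_schwartzRot, toLp_schwartzDilC]
  · have h := (hφ.schwartzDilC hκpos).schwartzRot R
    have hcentre : R (κ • c₀) = ξ₁ := by
      have hc₀' : c₀ = ‖c₀‖ • (‖c₀‖⁻¹ • c₀) := by rw [smul_inv_smul₀ hnc.ne']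
      rw [LinearIsometryEquiv.map_smul, hc₀', LinearIsometryEquiv.map_smul, hR, smul_smul,
        smul_smul, hκ, div_mul_cancel₀ _ hnc.ne', mul_inv_cancel₀ hnξ.ne', one_smul]
    rwa [hcentre] at h

end Literature.Analysis.FluidPDE.Tao2016
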